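import Literature.Barriers.CriticalPhenomena.SAPSections
import HarnessLib

/-!
# Column classes of self-avoiding polygons (haruspicy, layer 4b)

Companion of `SAPAnisotropicNotDFinite` (towards `Rechnitzer2006_thm1`). We complete the
reduction of Rechnitzer 2006, §2.1 (in its column-level form): every canonical word `u` with
`2n` vertical bonds is obtained in exactly one way by stretching a **column-minimal** canonical
word `w` (`Haruspicy.IsColMin`) by positive widths `t` on the gaps of `w`
(`u = restretch t 0 w`), namely `w = contract u` and `t = tauOf u`; and the number of horizontal
bonds of `u` is `Σ_g 2 k_g(w) t_g`, where `2 k_g(w)` is the number of horizontal bonds of `w`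
across the gap `g` (even, by the crossing parity of a closed curve). The column-minimal words
with `2n` vertical bonds are finitely many (they fit in a `2n × (4n+1)` box). Consequently
(`card_canonWords_eq_sum`)

  `p_{m,n} = #canonWords (2(m+n)) (2m) = Σ_{w ∈ colMinWords n} #{t : gaps w → [1, m] | Σ_g k_g(w) t_g = m}`,

the combinatorial content of "`H_n(x)` may be written as the sum of simple rational functions"
(Rechnitzer 2006, after Lemma 5). [folklore] throughout.

## Contents

* `gaps w`, `hgap w g`, `kgap w g` (gaps crossed; horizontal bonds / `E`-bonds across `g`),
  `hgap_eq_two_mul_kgap` (crossing parity), `hcount_restretch_eq_sum`;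
* the stretch direction: `isCanon_restretch`, `secCols_restretch`, `contract_restretch`,
  `tauOf_restretch`;
* finiteness `IsCanon.length_le_of_isColMin`, `colMinWords n`, `mem_colMinWords`;
* `tset w m`, `card_canonWords_eq_sum`.

## References

* A. Rechnitzer, *Haruspicy 2*, J. Combin. Theory Ser. A 113 (2006), §2.1, Lemma 5 and the
  paragraph following it. [Rechnitzer2006Haruspicy2]
-/

noncomputable section

open Finset Literature.Probability.LatticeModels Literature.Probability.Percolation
open scoped BigOperators

namespace Literature.Barriers.CriticalPhenomena

namespace Haruspicy

open Edwards2D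

variable {u w : List (Fin 4)}

/-! ### Gaps and crossing numbers -/

/-- The set of gaps crossed by the horizontal letters of `w` (read from column `0`). [folklore] -/
def gaps (w : List (Fin 4)) : Finset ℤ :=
  ((Finset.range w.length).filter fun i => (w.getD i 0).val < 2).image
    fun i => gapOf (vtx w i 0) (w.getD i 0)

/-- Membership in `gaps`. [folklore] -/
theorem mem_gaps {g : ℤ} :
    g ∈ gaps w ↔ ∃ i < w.length, (w.getD i 0).val < 2 ∧ gapOf (vtx w i 0) (w.getD i 0) = g := by
  simp [gaps, and_assoc]

/-- The gap of an `E` read at column `x` is `[x, x+1]`. [folklore] -/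
@[simp] theorem gapOf_E (x : ℤ) : gapOf x 0 = x := by
  simp [gapOf]

/-- The gap of a `W` read at column `x` is `[x-1, x]`. [folklore] -/
@[simp] theorem gapOf_W (x : ℤ) : gapOf x 1 = x - 1 := by
  simp [gapOf]

/-- The number of horizontal letters of `w` across the gap `g`. [folklore] -/
def hgap (w : List (Fin 4)) (g : ℤ) : ℕ :=
  ((Finset.range w.length).filter fun i =>
    (w.getD i 0).val < 2 ∧ gapOf (vtx w i 0) (w.getD i 0) = g).card

/-- `k_g(w)`: the number of `E`-letters of `w` across the gap `g` (half of `hgap`, below).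
[folklore] -/
def kgap (w : List (Fin 4)) (g : ℤ) : ℕ :=
  ((Finset.range w.length).filter fun i => w.getD i 0 = 0 ∧ vtx w i 0 = g).card

/-- A crossed gap is crossed at least once. [folklore] -/
theorem one_le_hgap {g : ℤ} (hg : g ∈ gaps w) : 1 ≤ hgap w g := by
  obtain ⟨i, hi, hh, hgi⟩ := mem_gaps.1 hg
  exact Finset.card_pos.2 ⟨i, Finset.mem_filter.2 ⟨Finset.mem_range.2 hi, hh, hgi⟩⟩

/-- The four letters. [folklore] -/
theorem fin4_cases (a : Fin 4) : a = 0 ∨ a = 1 ∨ a = 2 ∨ a = 3 := by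
  fin_cases a <;> simp

/-- **Crossing balance, one step**: (`E`-crossing of the gap `g` at step `j`) minus
(`W`-crossing) is the change of the indicator "to the right of `g`". [folklore] -/
theorem cross_step (w : List (Fin 4)) (g : ℤ) {j : ℕ} (hj : j < w.length) :
    ((if w.getD j 0 = 0 ∧ vtx w j 0 = g then 1 else 0 : ℤ) -
        if w.getD j 0 = 1 ∧ vtx w j 0 = g + 1 then 1 else 0) =
      (if g < vtx w (j + 1) 0 then 1 else 0) - if g < vtx w j 0 then 1 else 0 := by
  rw [vtx_succ w hj, Pi.add_apply, ← List.getD_eq_getElem w 0 hj]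
  rcases fin4_cases (w.getD j 0) with h | h | h | h <;> rw [h] <;> simp <;> split_ifs <;> omega

/-- **Crossing parity**: a closed word crosses every gap as often eastwards as westwards.
[folklore] -/
theorem kgap_eq_card_W (hc : (w.map stepVec).sum = 0) (g : ℤ) :
    kgap w g = ((Finset.range w.length).filter fun j => w.getD j 0 = 1 ∧ vtx w j 0 = g + 1).card := by
  have h1 : (kgap w g : ℤ) = ∑ j ∈ Finset.range w.length,
      (if w.getD j 0 = 0 ∧ vtx w j 0 = g then 1 else 0 : ℤ) := by
    rw [kgap, Finset.natCast_card_filter]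
  have h2 : ((((Finset.range w.length).filter fun j => w.getD j 0 = 1 ∧ vtx w j 0 = g + 1).card
      : ℕ) : ℤ) = ∑ j ∈ Finset.range w.length,
        (if w.getD j 0 = 1 ∧ vtx w j 0 = g + 1 then 1 else 0 : ℤ) := by
    rw [Finset.natCast_card_filter]
  have h3 : ∑ j ∈ Finset.range w.length, ((if w.getD j 0 = 0 ∧ vtx w j 0 = g then 1 else 0 : ℤ) -
      if w.getD j 0 = 1 ∧ vtx w j 0 = g + 1 then 1 else 0) =
      ∑ j ∈ Finset.range w.length,
        ((if g < vtx w (j + 1) 0 then 1 else 0 : ℤ) - if g < vtx w j 0 then 1 else 0) :=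
    Finset.sum_congr rfl fun j hj => cross_step w g (Finset.mem_range.1 hj)
  rw [Finset.sum_range_sub (fun j => if g < vtx w j 0 then (1 : ℤ) else 0), vtx_length, hc,
    vtx_zero, sub_self, Finset.sum_sub_distrib, ← h1, ← h2] at h3
  omega

/-- The number of horizontal bonds across `g` is `2 k_g` for a closed word. [folklore] -/
theorem hgap_eq_two_mul_kgap (hc : (w.map stepVec).sum = 0) (g : ℤ) : hgap w g = 2 * kgap w g := by
  have hsplit : ((Finset.range w.length).filter fun i =>
      (w.getD i 0).val < 2 ∧ gapOf (vtx w i 0) (w.getD i 0) = g) =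
      ((Finset.range w.length).filter fun j => w.getD j 0 = 0 ∧ vtx w j 0 = g) ∪
        ((Finset.range w.length).filter fun j => w.getD j 0 = 1 ∧ vtx w j 0 = g + 1) := by
    rw [← Finset.filter_or]
    apply Finset.filter_congr
    intro i _
    rcases fin4_cases (w.getD i 0) with h | h | h | h <;> rw [h] <;> simp
    omega
  rw [hgap, hsplit, Finset.card_union_of_disjoint, ← kgap_eq_card_W hc, kgap]
  · omega
  · rw [Finset.disjoint_filter]
    rintro i - ⟨h0, -⟩ ⟨h1, -⟩
    rw [h0] at h1
    exact absurd h1 (by decide)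

/-- `k_g ≥ 1` on every crossed gap of a closed word. [folklore] -/
theorem one_le_kgap (hc : (w.map stepVec).sum = 0) {g : ℤ} (hg : g ∈ gaps w) : 1 ≤ kgap w g := by
  have := one_le_hgap hg
  rw [hgap_eq_two_mul_kgap hc] at this
  omega

/-- **Horizontal bonds after stretching**: `hcount (restretch t 0 w) = Σ_{g ∈ gaps w} hgap_g · t g`.
[folklore] -/
theorem hcount_restretch_eq_sum (t : ℤ → ℕ) (w : List (Fin 4)) :
    hcount (restretch t 0 w) = ∑ g ∈ gaps w, hgap w g * t g := by
  rw [hcount_restretch]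
  simp only [zero_add]
  rw [← Finset.sum_filter, Finset.sum_comp]
  refine Finset.sum_congr rfl fun g _ => ?_
  rw [smul_eq_mul, hgap, Finset.filter_filter]

/-! ### Stretching a column-minimal word: the new word is canonical -/

/-- Every vertex column of a column-minimal canonical word is a section column (including the
closing one). [folklore] -/
theorem IsColMin.vtx_mem_secCols (hw : IsCanon w) (hcm : IsColMin w) {K : ℕ} (hK : K ≤ w.length) :
    vtx w K 0 ∈ secCols w := by
  rcases hK.lt_or_eq with h | rfl
  · exact hcm K h
  · rw [hw.1.vtx_length_zero]
    exact hw.zero_mem_secCols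

/-- Block starts dominate the block index. [folklore] -/
theorem le_bs {t : ℤ → ℕ} (ht : ∀ g, 1 ≤ t g) (w : List (Fin 4)) :
    ∀ K ≤ w.length, K ≤ bs t w K
  | 0, _ => by simp
  | K + 1, hK => by
    have h : K < w.length := hK
    rw [bs_succ t w h]
    have := le_bs ht w K h.le
    have := one_le_mult ht (vtx w K 0) w[K]
    omega

/-- **Edge simplicity**: a SAP word traverses each horizontal edge at most once — two horizontal
letters across the same gap at the same height have the same index. [folklore] -/
theorem IsSAP.eq_of_gap_eq (h : IsSAP w) {K K' : ℕ} (hK : K < w.length) (hK' : K' < w.length)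
    (ha : (w.getD K 0).val < 2) (ha' : (w.getD K' 0).val < 2)
    (hg : gapOf (vtx w K 0) (w.getD K 0) = gapOf (vtx w K' 0) (w.getD K' 0))
    (hy : vtx w K 1 = vtx w K' 1) : K = K' := by
  have hN := h.1
  -- the two letters
  have h01 : ∀ a : Fin 4, a.val < 2 → a = 0 ∨ a = 1 := by
    intro a ha; fin_cases a <;> simp at ha ⊢
  -- same direction: same starting vertex
  have same : ∀ K K', K < w.length → K' < w.length → vtx w K 0 = vtx w K' 0 →
      vtx w K 1 = vtx w K' 1 → K = K' := by
    intro K K' hK hK' h0 h1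
    exact h.2.2 (Set.mem_Iio.2 hK) (Set.mem_Iio.2 hK') (site_eq_iff.2 ⟨h0, h1⟩)
  -- opposite directions: the walk would backtrack along the edge
  have opp : ∀ K K', K < w.length → K' < w.length → w.getD K 0 = 0 → w.getD K' 0 = 1 →
      vtx w K 0 = vtx w K' 0 - 1 → vtx w K 1 = vtx w K' 1 → False := by
    intro K K' hK hK' h0 h1 hx hy
    have hvK : vtx w (K + 1) = vtx w K' := by
      rw [vtx_succ w hK, ← List.getD_eq_getElem w 0 hK, h0, site_eq_iff]
      simp only [Pi.add_apply, stepVec_zero, Fin.isValue, Pi.single_eq_same, ne_eq, one_ne_zero,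
        not_false_eq_true, Pi.single_eq_of_ne, add_zero]
      omega
    have hvK' : vtx w (K' + 1) = vtx w K := by
      rw [vtx_succ w hK', ← List.getD_eq_getElem w 0 hK', h1, site_eq_iff]
      simp only [Pi.add_apply, stepVec_one, Fin.isValue, Pi.neg_apply, Pi.single_eq_same, ne_eq,
        one_ne_zero, not_false_eq_true, Pi.single_eq_of_ne, neg_zero, add_zero]
      omega
    have m1 := h.mod_eq_mod (i := K + 1) (j := K') hK hK'.le hvK
    have m2 := h.mod_eq_mod (i := K' + 1) (j := K) hK' hK.le hvK'
    rw [Nat.mod_eq_of_lt hK'] at m1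
    rw [Nat.mod_eq_of_lt hK] at m2
    rcases (show K + 1 < w.length ∨ K + 1 = w.length by omega) with h3 | h3 <;>
      rcases (show K' + 1 < w.length ∨ K' + 1 = w.length by omega) with h4 | h4
    · rw [Nat.mod_eq_of_lt h3] at m1; rw [Nat.mod_eq_of_lt h4] at m2; omega
    · rw [Nat.mod_eq_of_lt h3] at m1; rw [h4, Nat.mod_self] at m2; omega
    · rw [h3, Nat.mod_self] at m1; rw [Nat.mod_eq_of_lt h4] at m2; omega
    · rw [h3, Nat.mod_self] at m1; rw [h4, Nat.mod_self] at m2; omega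
  rcases h01 _ ha with h0 | h0 <;> rcases h01 _ ha' with h1 | h1 <;>
    simp only [h0, h1, gapOf_E, gapOf_W] at hg
  · exact same K K' hK hK' hg hy
  · exact (opp K K' hK hK' h0 h1 (by omega) hy).elim
  · exact (opp K' K hK' hK h1 h0 (by omega) hy.symm).elim
  · exact same K K' hK hK' (by omega) hy

/-- **Stretching a canonical word by positive widths gives a SAP word**: vertices of the new
word are `(Φ_t(x_K) ± s, y_K)` (block `K`, offset `s`), and these are pairwise distinct by the
floor decomposition for `Φ_t`, self-avoidance and edge simplicity of `w`. [folklore] -/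
theorem isSAP_restretch (hw : IsCanon w) {t : ℤ → ℕ} (ht : ∀ g, 1 ≤ t g) :
    IsSAP (restretch t 0 w) := by
  have hsap := hw.1
  refine ⟨?_, ?_, ?_⟩
  · -- length
    have := le_bs ht w w.length le_rfl
    rw [bs_length] at this
    exact hsap.1.trans this
  · -- closed
    rw [← vtx_length, site_eq_iff, vtx_restretch_length_zero, vtx_restretch_length_one, zero_add,
      Phi_zero, sub_zero, hsap.vtx_length_zero, Phi_zero, vtx_length, hsap.2.1]
    exact ⟨rfl, rfl⟩
  · -- self-avoiding
    intro J hJ J' hJ' hJJ'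
    rw [Set.mem_Iio] at hJ hJ'
    obtain ⟨K, s, hK, hs, rfl⟩ := exists_bs t w hJ
    obtain ⟨K', s', hK', hs', rfl⟩ := exists_bs t w hJ'
    rw [vtx_bs_add t w hK hs.le, vtx_bs_add t w hK' hs'.le, site_eq_iff] at hJJ'
    simp only [Pi.add_apply, vtx_bs_zero t w hK.le, vtx_bs_zero t w hK'.le,
      vtx_bs_one t w hK.le, vtx_bs_one t w hK'.le] at hJJ'
    obtain ⟨hx, hy⟩ := hJJ'
    simp only [Pi.smul_apply, nsmul_eq_mul] at hx hy
    have hgetK := List.getD_eq_getElem w 0 hK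
    have hgetK' := List.getD_eq_getElem w 0 hK'
    -- horizontal letters keep the height
    have hmultv : ∀ (a : Fin 4) (x : ℤ), 2 ≤ a.val → mult t x a = 1 := by
      intro a x ha; rw [mult, if_neg (by omega)]
    -- floor form of the column of a vertex in block (a, x) at offset s < mult
    have floor : ∀ (a : Fin 4) (x : ℤ) (s : ℕ), s < mult t x a →
        ∃ g σ : ℤ, 0 ≤ σ ∧ σ < t g ∧ Phi t x + s * stepVec a 0 = Phi t g + σ ∧
          (σ = 0 ↔ s = 0) ∧ (0 < s → a.val < 2 ∧ g = gapOf x a) := by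
      intro a x s hs
      by_cases ha : 2 ≤ a.val
      · rw [hmultv a x ha] at hs
        have hs0 : s = 0 := by omega
        subst hs0
        refine ⟨x, 0, le_rfl, by have := ht x; omega, by simp, by simp, by simp⟩
      · have h01 : a = 0 ∨ a = 1 := by
          revert ha; generalize a = b; intro hb; fin_cases b <;> simp at hb ⊢
        rcases h01 with rfl | rfl
        · rw [mult_E] at hs
          refine ⟨x, s, by positivity, by exact_mod_cast hs, by simp, by simp, fun _ => ⟨by decide, ?_⟩⟩
          simp [gapOf]
        · rw [mult_W] at hs
          rcases Nat.eq_zero_or_pos s with rfl | hpos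
          · refine ⟨x, 0, le_rfl, by have := ht x; omega, by simp, by simp, by simp⟩
          · refine ⟨x - 1, t (x - 1) - s, by omega, by omega, ?_, by omega, fun _ => ⟨by decide, ?_⟩⟩
            · have := Phi_succ t (x - 1)
              rw [sub_add_cancel] at this
              simp only [stepVec_one, Fin.isValue, Pi.neg_apply, Pi.single_eq_same, mul_neg, mul_one]
              omega
            · simp [gapOf]
    obtain ⟨g, σ, hσ0, hσ1, hfx, hσs, hpos⟩ := floor w[K] (vtx w K 0) s hs
    obtain ⟨g', σ', hσ0', hσ1', hfx', hσs', hpos'⟩ := floor w[K'] (vtx w K' 0) s' hs'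
    rw [hfx, hfx'] at hx
    obtain ⟨hgg', hσσ'⟩ := Phi_block_inj t hσ0 hσ1 hσ0' hσ1' hx
    subst hgg' hσσ'
    rcases Nat.eq_zero_or_pos s with rfl | hspos
    · -- block start vs ...
      have hs'0 : s' = 0 := hσs'.1 (hσs.2 rfl)
      subst hs'0
      simp only [Nat.cast_zero, zero_mul, add_zero] at hy hfx hfx'
      have hxx : vtx w K 0 = vtx w K' 0 := by
        have e : Phi t (vtx w K 0) = Phi t (vtx w K' 0) := by rw [hfx, hfx']
        exact (Phi_strictMono t ht).injective e
      have := hsap.2.2 (Set.mem_Iio.2 hK) (Set.mem_Iio.2 hK') (site_eq_iff.2 ⟨hxx, hy⟩)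
      subst this
      rfl
    · have hs'pos : 0 < s' := by
        rcases Nat.eq_zero_or_pos s' with h0 | h0
        · exact absurd (hσs.1 (hσs'.2 h0)) (by omega)
        · exact h0
      obtain ⟨haK, hgK⟩ := hpos hspos
      obtain ⟨haK', hgK'⟩ := hpos' hs'pos
      have hyK : stepVec w[K] 1 = 0 := stepVec_apply_one_eq_zero haK
      have hyK' : stepVec w[K'] 1 = 0 := stepVec_apply_one_eq_zero haK'
      rw [hyK, hyK', mul_zero, mul_zero, add_zero, add_zero] at hy
      have hKK' : K = K' := hsap.eq_of_gap_eq hK hK' (by rwa [hgetK]) (by rwa [hgetK'])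
        (by rw [hgetK, hgetK', ← hgK, ← hgK']) hy
      subst hKK'
      -- same block: the offsets agree
      congr 1
      have h01 : w[K] = 0 ∨ w[K] = 1 := by
        revert haK; generalize w[K] = b; intro hb; fin_cases b <;> simp at hb ⊢
      rcases h01 with h0 | h0 <;> simp only [h0, stepVec_zero, stepVec_one, Fin.isValue,
        Pi.single_eq_same, Pi.neg_apply, mul_one, mul_neg] at hfx hfx' <;> omega

/-- **Stretching a canonical word by positive widths gives a canonical word.** [folklore] -/
theorem isCanon_restretch (hw : IsCanon w) {t : ℤ → ℕ} (ht : ∀ g, 1 ≤ t g) :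
    IsCanon (restretch t 0 w) := by
  refine ⟨isSAP_restretch hw ht, ?_, ?_⟩
  · -- rooted
    intro J hJ
    obtain ⟨K, s, hK, hs, rfl⟩ := exists_bs t w hJ
    have hr := hw.2.1 K hK
    rw [key_le_key] at hr ⊢
    rw [vtx_bs_add t w hK hs.le]
    simp only [Pi.zero_apply, Pi.add_apply, vtx_bs_zero t w hK.le, vtx_bs_one t w hK.le] at hr ⊢
    simp only [Pi.smul_apply, nsmul_eq_mul]
    by_cases ha : 2 ≤ (w[K]).val
    · have hs0 : s = 0 := by rw [mult, if_neg (by omega)] at hs; omega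
      subst hs0
      simp only [Nat.cast_zero, zero_mul, add_zero]
      rcases hr with hr | ⟨hr1, hr2⟩
      · exact Or.inl hr
      · exact Or.inr ⟨hr1, (Phi_nonneg_iff ht).2 hr2⟩
    · rw [stepVec_apply_one_eq_zero (not_le.1 ha), mul_zero, add_zero]
      rcases hr with hr | ⟨hr1, hr2⟩
      · exact Or.inl hr
      · refine Or.inr ⟨hr1, ?_⟩
        have hP : 0 ≤ Phi t (vtx w K 0) := (Phi_nonneg_iff ht).2 hr2
        have h01 : w[K] = 0 ∨ w[K] = 1 := by
          revert ha; generalize w[K] = b; intro hb; fin_cases b <;> simp at hb ⊢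
        rcases h01 with h0 | h0
        · rw [h0]
          simp only [stepVec_zero, Fin.isValue, Pi.single_eq_same, mul_one]
          positivity
        · rw [h0] at hs ⊢
          rw [mult_W] at hs
          simp only [stepVec_one, Fin.isValue, Pi.neg_apply, Pi.single_eq_same, mul_neg, mul_one]
          -- the W step ends at a vertex of non-negative key on row 0, so `x_K - 1 ≥ 0`
          have hx1 : 0 ≤ vtx w K 0 - 1 := by
            have hvs := vtx_succ w hK
            rw [h0] at hvs
            have hnext : key 0 ≤ key (vtx w (K + 1)) := by
              rcases (show K + 1 < w.length ∨ K + 1 = w.length by omega) with h' | h'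
              · exact hw.2.1 _ h'
              · rw [h', vtx_length, hw.1.2.1]
            rw [key_le_key, hvs] at hnext
            simp only [Pi.zero_apply, Pi.add_apply, stepVec_one, Fin.isValue, Pi.neg_apply,
              Pi.single_eq_same, ne_eq, one_ne_zero, not_false_eq_true, Pi.single_eq_of_ne,
              neg_zero, add_zero] at hnext
            omega
          have := Phi_succ t (vtx w K 0 - 1)
          rw [sub_add_cancel] at this
          have hP1 : 0 ≤ Phi t (vtx w K 0 - 1) := (Phi_nonneg_iff ht).2 hx1
          have : (s : ℤ) ≤ t (vtx w K 0 - 1) := by exact_mod_cast hs.le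
          omega
  · -- first letter
    have hu : w = 0 :: w.tail := by
      have := hw.2.2
      cases w with
      | nil => simp at this
      | cons a w' =>
        simp only [List.head?_cons, Option.some.injEq] at this
        simp [this]
    conv_lhs => arg 1; arg 3; rw [hu]
    rw [restretch_cons, mult_E]
    obtain ⟨k, hk⟩ : ∃ k, t 0 = k + 1 := Nat.exists_eq_add_one_of_ne_zero (by have := ht 0; omega)
    rw [hk, List.replicate_succ]
    rfl

/-- **Section columns after stretching** are the images `Φ_t` of the section columns.
[folklore] -/
theorem secCols_restretch (t : ℤ → ℕ) (w : List (Fin 4)) :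
    secCols (restretch t 0 w) = (secCols w).image (Phi t) := by
  ext c
  rw [mem_secCols, Finset.mem_image]
  constructor
  · rintro ⟨J, hJ, hv, rfl⟩
    obtain ⟨K, s, hK, hs, rfl⟩ := exists_bs t w hJ
    rw [getD_bs_add t w hK hs] at hv
    have hs0 : s = 0 := by rw [mult, if_neg (by omega)] at hs; omega
    subst hs0
    refine ⟨vtx w K 0, mem_secCols.2 ⟨K, hK, by rwa [List.getD_eq_getElem w 0 hK], rfl⟩, ?_⟩
    rw [add_zero, vtx_bs_zero t w hK.le]
  · rintro ⟨x, hx, rfl⟩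
    obtain ⟨K, hK, hv, rfl⟩ := mem_secCols.1 hx
    have hm : mult t (vtx w K 0) w[K] = 1 := by
      rw [mult, if_neg]; rw [← List.getD_eq_getElem w 0 hK]; omega
    have hJ : bs t w K < (restretch t 0 w).length := by
      have h1 := bs_succ t w hK
      have h2 := bs_mono t w (show K + 1 ≤ w.length by omega)
      rw [bs_length] at h2
      omega
    refine ⟨bs t w K, hJ, ?_, vtx_bs_zero t w hK.le⟩
    have := getD_bs_add t w hK (s := 0) (by omega)
    rw [add_zero] at this
    rwa [this, ← List.getD_eq_getElem w 0 hK]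

/-- The gap of a horizontal letter of a column-minimal canonical word starts at a section column,
and so does the next column. [folklore] -/
theorem IsColMin.gapOf_mem_secCols (hw : IsCanon w) (hcm : IsColMin w) {i : ℕ} (hi : i < w.length)
    (ha : (w.getD i 0).val < 2) :
    gapOf (vtx w i 0) (w.getD i 0) ∈ secCols w ∧ gapOf (vtx w i 0) (w.getD i 0) + 1 ∈ secCols w ∧
      (∃ K ≤ w.length, vtx w K 0 = gapOf (vtx w i 0) (w.getD i 0)) ∧
      ∃ K ≤ w.length, vtx w K 0 = gapOf (vtx w i 0) (w.getD i 0) + 1 := by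
  have hxi := hcm.vtx_mem_secCols hw hi.le
  have hxi1 := hcm.vtx_mem_secCols hw (show i + 1 ≤ w.length by omega)
  have hvs := vtx_succ w hi
  rw [← List.getD_eq_getElem w 0 hi] at hvs
  have hvs0 := congrFun hvs 0
  simp only [Pi.add_apply] at hvs0
  have h01 : w.getD i 0 = 0 ∨ w.getD i 0 = 1 := by
    revert ha; generalize w.getD i 0 = b; intro hb; fin_cases b <;> simp at hb ⊢
  rcases h01 with h0 | h0 <;> rw [h0] at hvs0 ⊢ <;>
    simp only [gapOf_E, gapOf_W, stepVec_zero, stepVec_one, Fin.isValue,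
      Pi.single_eq_same, Pi.neg_apply] at hvs0 ⊢
  · refine ⟨hxi, by rw [← hvs0]; exact hxi1, ⟨i, hi.le, rfl⟩, ⟨i + 1, by omega, hvs0⟩⟩
  · refine ⟨?_, by rw [sub_add_cancel]; exact hxi, ⟨i + 1, by omega, by rw [hvs0]; ring⟩,
      ⟨i, hi.le, by ring⟩⟩
    have : vtx w (i + 1) 0 = vtx w i 0 - 1 := by rw [hvs0]; ring
    rw [← this]
    exact hxi1

/-- In the image `Φ_t(S)` of the section columns, the only point of a block
`[Φ_t g, Φ_t g + t g)` with `g ∈ S` is its start. [folklore] -/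
theorem Phi_add_mem_image_iff {t : ℤ → ℕ} (ht : ∀ g, 1 ≤ t g) {S : Finset ℤ} {g : ℤ} (hg : g ∈ S)
    {j : ℤ} (hj0 : 0 ≤ j) (hj : j < t g) : Phi t g + j ∈ S.image (Phi t) ↔ j = 0 := by
  constructor
  · intro h
    obtain ⟨c, -, hc⟩ := Finset.mem_image.1 h
    have := Phi_block_inj t hj0 hj le_rfl (by have := ht c; omega) (hc.symm.trans (add_zero _).symm)
    exact this.2
  · rintro rfl
    rw [add_zero]
    exact Finset.mem_image_of_mem _ hg

/-- **Contracting a stretched column-minimal word gives it back.** [folklore] -/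
theorem contract_restretch (hw : IsCanon w) (hcm : IsColMin w) {t : ℤ → ℕ} (ht : ∀ g, 1 ≤ t g) :
    contract (restretch t 0 w) = w := by
  rw [contract]
  have hcomp := restretch_restretch t (chi (restretch t 0 w)) 0 w
  rw [Phi_zero] at hcomp
  rw [hcomp]
  apply restretch_eq_self
  intro i hi ha
  rw [zero_add]
  obtain ⟨hgS, -, -, -⟩ := hcm.gapOf_mem_secCols hw hi ha
  set g := gapOf (vtx w i 0) (w.getD i 0)
  rw [comp]
  have : ∀ j ∈ Finset.range (t g), chi (restretch t 0 w) (Phi t g + j) = if j = 0 then 1 else 0 := by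
    intro j hj
    rw [Finset.mem_range] at hj
    rw [chi, secCols_restretch]
    have key := Phi_add_mem_image_iff ht hgS (j := j) (by positivity) (by exact_mod_cast hj)
    by_cases hj0 : j = 0
    · rw [if_pos (key.2 (by exact_mod_cast hj0)), if_pos hj0]
    · rw [if_neg (fun h => hj0 (by exact_mod_cast key.1 h)), if_neg hj0]
  rw [Finset.sum_congr rfl this, Finset.sum_ite_eq']
  rw [if_pos (Finset.mem_range.2 (show 0 < t g from ht g))]

/-- `Φ_χ ∘ Φ_t` is the identity on the columns visited by a column-minimal canonical word (all
of which, by the intermediate value property, are section columns together with every column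
between them and `0`). [folklore] -/
theorem Phi_chi_Phi_vtx (hw : IsCanon w) (hcm : IsColMin w) {t : ℤ → ℕ} (ht : ∀ g, 1 ≤ t g) {K : ℕ}
    (hK : K ≤ w.length) :
    Phi (chi (restretch t 0 w)) (Phi t (vtx w K 0)) = vtx w K 0 := by
  set u := restretch t 0 w with hu
  have hS : secCols u = (secCols w).image (Phi t) := secCols_restretch t w
  -- every column between 0 and x_K is a section column of w
  have hbetween : ∀ c : ℤ, min 0 (vtx w K 0) ≤ c → c ≤ max 0 (vtx w K 0) → c ∈ secCols w := by
    intro c h1 h2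
    have h1' : min (vtx w 0 0) (vtx w K 0) ≤ c := by simpa using h1
    have h2' : c ≤ max (vtx w 0 0) (vtx w K 0) := by simpa using h2
    obtain ⟨k, -, hk, rfl⟩ := exists_vtx_zero_eq w (Nat.zero_le K) h1' h2'
    exact hcm.vtx_mem_secCols hw (hk.trans hK)
  -- one step of Φ_χ across a block of u
  have hstep : ∀ c ∈ secCols w, Phi (chi u) (Phi t (c + 1)) = Phi (chi u) (Phi t c) + 1 := by
    intro c hc
    have hle : Phi t c ≤ Phi t (c + 1) := Phi_mono t (by omega)
    have h1 := Phi_sub_Phi (chi u) hle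
    rw [Finset.sum_eq_single_of_mem (Phi t c) (Finset.mem_Ico.2 ⟨le_rfl, by
      rw [Phi_succ]; have := ht c; omega⟩)] at h1
    · rw [chi, hS, if_pos (Finset.mem_image_of_mem _ hc)] at h1
      push_cast at h1
      omega
    · intro g' hg' hne
      rw [Finset.mem_Ico, Phi_succ] at hg'
      rw [chi, hS, if_neg, Nat.cast_zero]
      have key := Phi_add_mem_image_iff ht hc (j := g' - Phi t c) (by omega) (by omega)
      rw [add_sub_cancel] at key
      intro hmem
      have := key.1 hmem
      omega
  -- induction upwards and downwards from 0
  have hup : ∀ n : ℕ, (n : ℤ) ≤ max 0 (vtx w K 0) → Phi (chi u) (Phi t n) = n := by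
    intro n
    induction n with
    | zero => intro _; simp
    | succ n ih =>
      intro hn
      have h' := ih (by push_cast at hn ⊢; omega)
      have hc : (n : ℤ) ∈ secCols w :=
        hbetween n ((min_le_left _ _).trans (by positivity)) (by push_cast at hn; omega)
      have := hstep n hc
      push_cast
      rw [this, h']
  have hdown : ∀ n : ℕ, min 0 (vtx w K 0) ≤ -(n : ℤ) → Phi (chi u) (Phi t (-n)) = -n := by
    intro n
    induction n with
    | zero => intro _; simp
    | succ n ih =>
      intro hn
      have h' := ih (by push_cast at hn ⊢; omega)
      have hc : (-(n + 1 : ℕ) : ℤ) ∈ secCols w := hbetween _ hn (by push_cast; omega)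
      have := hstep _ hc
      rw [show -((n + 1 : ℕ) : ℤ) + 1 = -(n : ℤ) by push_cast; ring, h'] at this
      omega
  rcases le_total 0 (vtx w K 0) with h0 | h0
  · have := hup (vtx w K 0).toNat (by rw [Int.toNat_of_nonneg h0]; exact le_max_right _ _)
    rwa [Int.toNat_of_nonneg h0] at this
  · have := hdown (-vtx w K 0).toNat (by rw [Int.toNat_of_nonneg (by omega), neg_neg]; exact min_le_right _ _)
    rwa [Int.toNat_of_nonneg (by omega), neg_neg] at this

/-- **The re-inflating widths of a stretched column-minimal word are the stretching widths** (on
the gaps of the word). [folklore] -/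
theorem tauOf_restretch (hw : IsCanon w) (hcm : IsColMin w) {t : ℤ → ℕ} (ht : ∀ g, 1 ≤ t g) {g : ℤ}
    (hg : g ∈ gaps w) : tauOf (restretch t 0 w) g = t g := by
  set u := restretch t 0 w with hu
  have hS : secCols u = (secCols w).image (Phi t) := secCols_restretch t w
  obtain ⟨i, hi, ha, hgi⟩ := mem_gaps.1 hg
  obtain ⟨hgS, hg1S, ⟨K, hK, hKg⟩, -⟩ := hcm.gapOf_mem_secCols hw hi ha
  rw [hgi] at hgS hg1S hKg
  have hPg : Phi t g ∈ secCols u := by rw [hS]; exact Finset.mem_image_of_mem _ hgS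
  -- `tauOf u (Φ_χ (Φ_t g)) = theta u (Φ_t g)` and `Φ_χ (Φ_t g) = g`
  have h1 := tauOf_Phi_chi hPg
  rw [← hKg, Phi_chi_Phi_vtx hw hcm ht hK, hKg] at h1
  rw [h1]
  -- `theta u (Φ_t g) = Φ_t (g+1) - Φ_t g = t g`
  have hnext : nextIn (secCols u) (Phi t g) = Phi t (g + 1) := by
    have hex : ∃ c' ∈ secCols u, Phi t g < c' :=
      ⟨Phi t (g + 1), by rw [hS]; exact Finset.mem_image_of_mem _ hg1S,
        Phi_strictMono t ht (by omega)⟩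
    obtain ⟨hmem, hmin⟩ := nextIn_spec hex
    have hle := hmin _ (by rw [hS]; exact Finset.mem_image_of_mem _ hg1S)
      (Phi_strictMono t ht (by omega))
    obtain ⟨c, -, hc⟩ := Finset.mem_image.1
      (show nextIn (secCols u) (Phi t g) ∈ (secCols w).image (Phi t) by rw [← hS]; exact hmem)
    have hlt := lt_nextIn (secCols u) (Phi t g)
    rw [← hc] at hlt hle ⊢
    have hgc : g < c := by
      by_contra hh
      have := Phi_mono t (not_lt.1 hh)
      omega
    have := Phi_mono t (show g + 1 ≤ c by omega)
    omega
  have h2 := theta_of_mem hPg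
  rw [hnext, Phi_succ] at h2
  have h3 : (theta u (Phi t g) : ℤ) = t g := by omega
  exact_mod_cast h3

/-! ### Finiteness of the column-minimal words with `2n` vertical bonds -/

/-- **Column-minimal canonical words are short**: their vertices are distinct points with a
section column as abscissa and an ordinate bounded by `vcount`. [folklore] -/
theorem IsCanon.length_le_of_isColMin (hw : IsCanon w) (hcm : IsColMin w) :
    w.length ≤ vcount w * (2 * vcount w + 1) := by
  have hmap : Set.MapsTo (fun K => (vtx w K 0, vtx w K 1)) (Finset.range w.length : Set ℕ)
      ((secCols w) ×ˢ Finset.Icc (-(vcount w : ℤ)) (vcount w) : Finset (ℤ × ℤ)) := by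
    intro K hK
    rw [Finset.coe_range, Set.mem_Iio] at hK
    rw [Finset.mem_coe, Finset.mem_product, Finset.mem_Icc]
    exact ⟨hcm K hK, abs_le.1 (abs_vtx_one_le w K)⟩
  have hinj : Set.InjOn (fun K => (vtx w K 0, vtx w K 1)) (Finset.range w.length : Set ℕ) := by
    intro K hK K' hK' h
    rw [Finset.coe_range] at hK hK'
    simp only [Prod.mk.injEq] at h
    exact hw.1.2.2 hK hK' (site_eq_iff.2 h)
  have := Finset.card_le_card_of_injOn _ hmap hinj
  rw [Finset.card_range, Finset.card_product, Int.card_Icc] at this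
  have hS := card_secCols_le w
  have htoNat : ((vcount w : ℤ) + 1 - -(vcount w : ℤ)).toNat = 2 * vcount w + 1 := by
    rw [show (vcount w : ℤ) + 1 - -(vcount w : ℤ) = ((2 * vcount w + 1 : ℕ) : ℤ) by push_cast; ring,
      Int.toNat_natCast]
  rw [htoNat] at this
  calc w.length ≤ (secCols w).card * (2 * vcount w + 1) := this
    _ ≤ vcount w * (2 * vcount w + 1) := Nat.mul_le_mul_right _ hS

/-- A bound on the length of the column-minimal canonical words with `2n` vertical bonds.
[folklore] -/
def lenBound (n : ℕ) : ℕ := 2 * n * (4 * n + 1)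

open Classical in
/-- **The column-minimal canonical words with `2n` vertical bonds** (a finite set: the minimal
polygons of `𝒫_n` in the column-level reduction). [cite: Rechnitzer2006Haruspicy2, §2.1, Lemma 5] -/
def colMinWords (n : ℕ) : Finset (List (Fin 4)) :=
  ((Finset.range (lenBound n + 1)).biUnion wordsOfLength).filter
    fun w => IsCanon w ∧ IsColMin w ∧ vcount w = 2 * n

/-- Membership in `colMinWords`: the length bound is automatic. [folklore] -/
theorem mem_colMinWords {n : ℕ} : w ∈ colMinWords n ↔ IsCanon w ∧ IsColMin w ∧ vcount w = 2 * n := by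
  classical
  rw [colMinWords, Finset.mem_filter, Finset.mem_biUnion]
  constructor
  · exact fun h => h.2
  · rintro ⟨h1, h2, h3⟩
    refine ⟨⟨w.length, ?_, mem_wordsOfLength.2 rfl⟩, h1, h2, h3⟩
    rw [Finset.mem_range, Nat.lt_succ_iff, lenBound]
    have := h1.length_le_of_isColMin h2
    rw [h3] at this
    calc w.length ≤ 2 * n * (2 * (2 * n) + 1) := this
      _ = 2 * n * (4 * n + 1) := by ring

/-! ### The bijection and the count -/

/-- Extending widths given on the gaps of `w` by `1` elsewhere. [folklore] -/
def extT (w : List (Fin 4)) (t : ↥(gaps w) → ℕ) (g : ℤ) : ℕ :=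
  if h : g ∈ gaps w then t ⟨g, h⟩ else 1

/-- `extT` on a gap. [folklore] -/
theorem extT_of_mem {t : ↥(gaps w) → ℕ} {g : ℤ} (hg : g ∈ gaps w) : extT w t g = t ⟨g, hg⟩ := by
  rw [extT, dif_pos hg]

/-- The admissible width vectors of total horizontal half-perimeter `m`:
`t : gaps w → [1, m]` with `Σ_g k_g(w) t_g = m`. [folklore] -/
def tset (w : List (Fin 4)) (m : ℕ) : Finset (↥(gaps w) → ℕ) :=
  (Fintype.piFinset fun _ : ↥(gaps w) => Finset.Icc 1 m).filter
    fun t => ∑ g : ↥(gaps w), kgap w g.1 * t g = m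

/-- Membership in `tset`. [folklore] -/
theorem mem_tset {m : ℕ} {t : ↥(gaps w) → ℕ} :
    t ∈ tset w m ↔ (∀ g, t g ∈ Finset.Icc 1 m) ∧ ∑ g : ↥(gaps w), kgap w g.1 * t g = m := by
  rw [tset, Finset.mem_filter, Fintype.mem_piFinset]

/-- Equality in the sigma type of (word, widths on its gaps). [folklore] -/
theorem sigma_mk_eq {w w' : List (Fin 4)} (h : w' = w) (f : ℤ → ℕ) (t : ↥(gaps w) → ℕ)
    (hf : ∀ g : ↥(gaps w), f g.1 = t g) :
    (⟨w', fun g : ↥(gaps w') => f g.1⟩ : Σ v : List (Fin 4), ↥(gaps v) → ℕ) = ⟨w, t⟩ := by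
  subst h
  simp only [Sigma.mk.injEq, heq_eq_eq, true_and]
  funext g
  exact hf g

/-- The horizontal count of a stretched closed word in terms of `k_g`. [folklore] -/
theorem hcount_restretch_eq_two_mul (hc : (w.map stepVec).sum = 0) (t : ℤ → ℕ) :
    hcount (restretch t 0 w) = 2 * ∑ g ∈ gaps w, kgap w g * t g := by
  rw [hcount_restretch_eq_sum, Finset.mul_sum]
  refine Finset.sum_congr rfl fun g _ => ?_
  rw [hgap_eq_two_mul_kgap hc, mul_assoc]

/-- **The column-class decomposition of `p_{m,n}`**: canonical words of length `2(m+n)` with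
`2m` horizontal letters correspond bijectively to pairs (column-minimal canonical word `w` with
`2n` vertical letters, widths `t : gaps w → ℕ₊` with `Σ_g k_g(w) t_g = m`), via
`(w, t) ↦ restretch t 0 w` and `u ↦ (contract u, tauOf u)`.
[cite: Rechnitzer2006Haruspicy2, §2.1, Lemma 5] -/
theorem card_canonWords_eq_sum (m n : ℕ) :
    (canonWords (2 * (m + n)) (2 * m)).card = ∑ w ∈ colMinWords n, (tset w m).card := by
  rw [← Finset.card_sigma]
  symm
  apply Finset.card_nbij' (fun p => restretch (extT p.1 p.2) 0 p.1)
    (fun u => ⟨contract u, fun g => tauOf u g.1⟩)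
  · -- forward: lands in the canonical words
    rintro ⟨w, t⟩ hp
    rw [Finset.mem_coe, Finset.mem_sigma, mem_colMinWords, mem_tset] at hp
    obtain ⟨⟨hcan, hcm, hv⟩, ht1, hsum⟩ := hp
    have ht : ∀ g, 1 ≤ extT w t g := by
      intro g
      unfold extT
      split_ifs with h
      · exact (Finset.mem_Icc.1 (ht1 _)).1
      · exact le_rfl
    dsimp only
    rw [Finset.mem_coe, mem_canonWords]
    have hh : hcount (restretch (extT w t) 0 w) = 2 * m := by
      rw [hcount_restretch_eq_two_mul hcan.1.2.1, ← hsum,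
        ← Finset.sum_coe_sort (gaps w) (fun g => kgap w g * extT w t g)]
      congr 1
      refine Finset.sum_congr rfl fun g _ => ?_
      rw [extT_of_mem g.2]
    refine ⟨?_, isCanon_restretch hcan ht, hh⟩
    have := hcount_add_vcount (restretch (extT w t) 0 w)
    rw [hh, vcount_restretch, hv] at this
    omega
  · -- backward: lands in the sigma set
    intro u hu
    rw [Finset.mem_coe, mem_canonWords] at hu
    obtain ⟨hlen, hcan, hh⟩ := hu
    have hv : vcount u = 2 * n := by
      have := hcount_add_vcount u
      omega
    rw [Finset.mem_coe, Finset.mem_sigma, mem_colMinWords, mem_tset]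
    have hsum : ∑ g : ↥(gaps (contract u)), kgap (contract u) g.1 * tauOf u g.1 = m := by
      have h1 := hcount_restretch_eq_two_mul hcan.isCanon_contract.1.2.1 (tauOf u)
      rw [hcan.restretch_tauOf_contract, hh,
        ← Finset.sum_coe_sort (gaps (contract u)) (fun g => kgap (contract u) g * tauOf u g)] at h1
      omega
    refine ⟨⟨hcan.isCanon_contract, hcan.isColMin_contract, by rw [vcount_contract, hv]⟩,
      fun g => ?_, hsum⟩
    rw [Finset.mem_Icc]
    refine ⟨one_le_tauOf u g.1, ?_⟩
    have hk := one_le_kgap hcan.isCanon_contract.1.2.1 g.2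
    have hle := Finset.single_le_sum (f := fun g : ↥(gaps (contract u)) =>
      kgap (contract u) g.1 * tauOf u g.1) (fun _ _ => Nat.zero_le _) (Finset.mem_univ g)
    rw [hsum] at hle
    calc tauOf u g.1 ≤ kgap (contract u) g.1 * tauOf u g.1 := Nat.le_mul_of_pos_left _ hk
      _ ≤ m := hle
  · -- left inverse
    rintro ⟨w, t⟩ hp
    rw [Finset.mem_coe, Finset.mem_sigma, mem_colMinWords, mem_tset] at hp
    obtain ⟨⟨hcan, hcm, -⟩, ht1, -⟩ := hp
    have ht : ∀ g, 1 ≤ extT w t g := by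
      intro g
      unfold extT
      split_ifs with h
      · exact (Finset.mem_Icc.1 (ht1 _)).1
      · exact le_rfl
    dsimp only
    exact sigma_mk_eq (contract_restretch hcan hcm ht) (tauOf (restretch (extT w t) 0 w)) t
      fun g => by rw [tauOf_restretch hcan hcm ht g.2, extT_of_mem g.2]
  · -- right inverse
    intro u hu
    rw [Finset.mem_coe, mem_canonWords] at hu
    obtain ⟨-, hcan, -⟩ := hu
    dsimp only
    conv_rhs => rw [← hcan.restretch_tauOf_contract]
    apply restretch_congr
    intro i hi ha
    rw [zero_add, extT_of_mem (mem_gaps.2 ⟨i, hi, ha, rfl⟩)]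

end Haruspicy

end Literature.Barriers.CriticalPhenomena
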